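import Summits.BirchSwinnertonDyer.BirchSwinnertonDyer.Theorems.ByReductionTypeAtTwoSupersingularThetaHabitatMTTP2ItemsKit
import Summits.BirchSwinnertonDyer.BirchSwinnertonDyer.Theorems.ByReductionTypeAtTwoSupersingularUnitAnchorTransport
import HarnessLib

/-!
# Crux `SupersingularRankZeroAtTwo` (item stmt-BirchSwinnertonDyer-19097, route `ByReductionTypeAtTwo`, rung K4): the THETA-HABITAT road —
# the KATO / MILLER UPPER HALF `MissingUpperBoundAt W 2` from THREE route-TP2 items BY NAME (K2r0 20312 at the CM partner, K3 20308 and K4 20309 at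
# `W`) and the torsion-and-`μ` transport in the kernel — NO `λ`, NO layer certificate, NO item 21415 (seat `bsd-2adic-ss-1x` GEN 7; companion of GEN 6's
# `…ThetaHabitatMTTP2Items` p584588 / `…ThetaHabitatTP2ByName` p586580 and of this GEN's `…UnitAnchorTP2ItemsUpper` p597074)

HONEST FRAMING (cells `bsd-2adic` / `bsd-wall`; HUMAN RULINGS D-0036/D-0054/D-0074): THEOREMS ONLY — no definition, no named fact, no instance, no `sorry`;
THREE hypotheses are OPEN items of route `ThetaPartnerAtTwo` taken BY NAME — K2r0 `SignedMainConjectureCMTwoRankZero` (20312, at the CM partner `A`), K3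
`SignedKatoDivisibilityUpToAtTwo` (20308, at `W`), K4 `SignedControlAtTwo` (20309, at `W`); they are NOT proved here; closes no item; a HALF of BSD₂
(`MissingUpperBoundAt`, Miller's `ord₂ #Ш ≤ ord₂ #Ш_an`), not BSD₂; BSD is NOT proved by any of this. PARTITION (D-0054): X5@2 good-ss `a₂ = 0` THETA-HABITAT
sub-row (19/208 rank-`0` classes) × `p = 2` — types-the-object-of; bears_on K4 19097 · TP2 20312 · 20308 · 20309 · 21414 (CLOSED, kernel transport).

WHAT. GEN 6's full display `SSMazurTate.bsdp_two_of_thetaPartnerItems_of_sigmaShift_at` consumes FOUR items {20312, 20308, 20309, 21415} and two layer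
certificates; the item 21415 (`λ`-difference) and both certificates serve only the EXACTNESS of the main conjecture at `W`. For the UPPER half: K2r0 at the
CM partner `A` gives «`X⁺_A` torsion with `μ = 0`» as its first conjunct; the CLOSED child 21414 + glue transport it to `W` in the kernel
(`SSMazurTate.isTorsion_and_mu_eq_zero_of_cmPartner_two`); GEN 4's `SSUnitAnchor.signedUpperDivisibility_two_of_katoUpTo_of_mu_eq_zero` turns K3's
divisibility up to `2^m` into `char X⁺_W ∣ ϖ L♭_W`; lane A's `missingUpperBoundAt_two_of_signedUpperDivisibility_two` closes with K4's Kim term.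
* `SSMazurTate.missingUpperBoundAt_two_of_thetaPartnerItems_at` — the pair door (PUB {`hmod`, `hGZK`, `h2`} + ITEMS {`hK2`, `hK3`, `hK4`} + KERNEL);
* `SSThetaRoad.missingUpperBoundAt_two_baseChange_int_of_thetaPartnerItems_at` — kit twin on integer models (Tschirnhaus pair).

References: [Kobayashi2003] Thm. 1.2, 4.1; [Kato2004Asterisque] Thm. 12.4–12.5 (3); [BDKim2013] Cor. 3.15; [BDKim2009] Cor. 2.13; [PollackRubin2004] Thm. 7.3;
[AbbesUllmo1996] Thm. A; [Washington1997] §7.1, §13.2; [Miller2011LMS] Def. 1.1.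
-/

set_option autoImplicit false
-- the Theorems namespace of this sub repeats the summit name by design (D-0017 nested layout)
set_option linter.dupNamespace false

noncomputable section

open scoped Classical MatrixGroups ModularForm

open CongruenceSubgroup Polynomial WeierstrassCurve
  Literature.NumberTheory.EllipticCurves
  Literature.NumberTheory.EllipticCurves.ModularForms Literature.NumberTheory.EllipticCurves.Sprung2017
  Literature.NumberTheory.EllipticCurves.Rank1Residual Literature.NumberTheory.EllipticCurves.Rank1Residual.Typed
  Literature.NumberTheory.EllipticCurves.Kobayashi2003 Literature.NumberTheory.EllipticCurves.IwasawaDual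
  Literature.NumberTheory.IwasawaTheory
  ZpExtension Summit.BirchSwinnertonDyer.Rank1Residual Summit.BirchSwinnertonDyer.Rank1Residual.Supersingular
  Summit.BirchSwinnertonDyer.Rank1Residual.X5.O1 Summit.BirchSwinnertonDyer.Rank1Residual.X1.MuLambda
  Summit.BirchSwinnertonDyer.BirchSwinnertonDyer.Theses.ThetaPartnerAtTwo

namespace Summit.BirchSwinnertonDyer.BirchSwinnertonDyer.Theorems

namespace SSMazurTate

/-! ## §1 The pair door for the upper half -/

/-- **THETA-HABITAT ROAD, UPPER HALF — K2r0 AT THE PARTNER, K3/K4 AT `W`, NOTHING ELSE RESEARCH.** `W` non-CM of analytic rank `0`, good supersingular at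
`2` with `a₂ = 0`; `A` CM of analytic rank `0`, good ss at `2` with `a₂ = 0`; a Galois-equivariant `e : W[2] ≃ A[2]`. From PUB {`hmod`, `hGZK`, `h2`} and route
TP2's OPEN items BY NAME {`hK2 : SignedMainConjectureCMTwoRankZero` (20312, at `A`; only its first conjunct «`X⁺_A` torsion, `μ = 0`» is used),
`hK3 : SignedKatoDivisibilityUpToAtTwo` (20308), `hK4 : SignedControlAtTwo` (20309)}: `MissingUpperBoundAt W 2`. Chain: K2r0(i) at `A` ⇒ kernel transport
(`isTorsion_and_mu_eq_zero_of_cmPartner_two`: 21414 CLOSED + glue) ⇒ `X⁺_W` torsion, `μ = 0` ⇒ `signedUpperDivisibility_two_of_katoUpTo_of_mu_eq_zero` on K3 ⇒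
`char X⁺_W ∣ ϖ L♭_W` ⇒ `missingUpperBoundAt_two_of_signedUpperDivisibility_two` with K4's Kim term. NO `λ`, NO layer certificate, NO 21415. The three items are
hypotheses; a half of BSD₂; BSD is not proved by any of this. [cite: Kobayashi2003, Thm. 1.2 and Thm. 4.1] [cite: Kato2004Asterisque, Thm. 12.4–12.5 (3)]
[cite: BDKim2013, Cor. 3.15] [cite: BDKim2009, Cor. 2.13] [cite: PollackRubin2004, Thm. 7.3] [cite: AbbesUllmo1996, Thm. A] [cite: Miller2011LMS, Def. 1.1] -/
theorem missingUpperBoundAt_two_of_thetaPartnerItems_at (hmod : nonempty_modularParametrizationData)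
    (hGZK : rank_eq_analyticRank_of_analyticRank_le_one) (h2 : realPeriodRat_eq_unit_mul_plusPeriod_two)
    (hK2 : Summit.BirchSwinnertonDyer.BirchSwinnertonDyer.Theses.ThetaPartnerAtTwo.SignedMainConjectureCMTwoRankZero)
    (hK3 : Summit.BirchSwinnertonDyer.BirchSwinnertonDyer.Theses.ThetaPartnerAtTwo.SignedKatoDivisibilityUpToAtTwo)
    (hK4 : Summit.BirchSwinnertonDyer.BirchSwinnertonDyer.Theses.ThetaPartnerAtTwo.SignedControlAtTwo)
    (W : WeierstrassCurve ℚ) [W.IsElliptic] [W.IsGloballyMinimal] (hcm : ¬ W.HasCM) (hr : W.analyticRank = 0)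
    (hss : GoodSS W 2) (ha : W.frobeniusTrace 2 = 0)
    (A : WeierstrassCurve ℚ) [A.IsElliptic] [A.IsGloballyMinimal] (hAcm : A.HasCM) (hAr : A.analyticRank = 0)
    (hAss : GoodSS A 2) (hAa : A.frobeniusTrace 2 = 0)
    (e : WeierstrassCurve.geomTorsion W (2 : ℤ) ≃+ WeierstrassCurve.geomTorsion A (2 : ℤ))
    (he : ∀ (σ : Field.absoluteGaloisGroup ℚ) (P : WeierstrassCurve.geomTorsion W (2 : ℤ)), e (σ • P) = σ • e P) :
    MissingUpperBoundAt W 2 := by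
  have hLrat : hasEntireLFunction_rat := WeierstrassCurve.hasEntireLFunction_rat_of_exists_isNewformOf
    (exists_isNewformOf_of_nonempty_modularParametrizationData hmod)
  have hL : W.entireLFunction 1 ≠ 0 := (W.analyticRank_eq_zero_iff_holds (hLrat W)).mp hr
  -- K2r0 BY NAME at the CM partner: `X⁺_A` torsion with `μ = 0` (first conjunct)
  obtain ⟨hTμA, -⟩ := hK2 A hAcm hAr hAss hAa
  -- KERNEL transport to `W`
  have hmu : ∀ (κ : ZpExtension ℚ 2) (γ : Field.absoluteGaloisGroup ℚ), κ.IsCyclotomic → κ.IsTopGenerator γ →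
      ∀ D : SignedSelmerDualData W κ γ 1, Module.IsTorsion (IwasawaAlgebra 2) D.X ∧ D.mu = 0 := by
    intro κ γ hκ hγ D
    haveI : Module.Finite (IwasawaAlgebra 2) D.X := Kobayashi2003.SignedSelmerDualData.moduleFinite hγ D
    obtain ⟨DA⟩ := nonempty_signedSelmerDualData A κ (1 : ℤˣ) hγ
    haveI : Module.Finite (IwasawaAlgebra 2) DA.X := Kobayashi2003.SignedSelmerDualData.moduleFinite hγ DA
    obtain ⟨hXA, hμA⟩ := hTμA κ γ hκ hγ DA
    exact isTorsion_and_mu_eq_zero_of_cmPartner_two W hcm hr hss ha A hAcm hAss hAa e he κ γ hκ hγ D DA hXA hμA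
  -- K4 BY NAME at `W`: Kim's term; finite generation is the tree theorem, torsion is `hmu`
  obtain ⟨_, hKim⟩ := hK4 W hcm hr hss ha
  have h12 : ∀ (κ : ZpExtension ℚ 2) (γ : Field.absoluteGaloisGroup ℚ), κ.IsCyclotomic → κ.IsTopGenerator γ →
      ∀ D : SignedSelmerDualData W κ γ 1,
        Module.Finite (IwasawaAlgebra 2) D.X ∧ Module.IsTorsion (IwasawaAlgebra 2) D.X :=
    fun κ γ hκ hγ D => ⟨Kobayashi2003.SignedSelmerDualData.moduleFinite hγ D, (hmu κ γ hκ hγ D).1⟩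
  -- K3 BY NAME at `W` + `μ = 0` ⇒ exact upper divisibility ⇒ the Miller upper half
  exact missingUpperBoundAt_two_of_signedUpperDivisibility_two W hmod hGZK hss.1 ha hL h12 hKim
    (SSUnitAnchor.signedUpperDivisibility_two_of_katoUpTo_of_mu_eq_zero W h2 hss (hK3 W hcm hr hss ha) hmu)

end SSMazurTate

/-! ## §2 The kit twin on integer models -/

namespace SSThetaRoad

section Door

variable (ME MA : WeierstrassCurve ℤ)
  [(ME.baseChange ℚ).IsElliptic] [(ME.baseChange ℚ).IsGloballyMinimal]
  [(MA.baseChange ℚ).IsElliptic] [(MA.baseChange ℚ).IsGloballyMinimal]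

/-- **KIT DOOR, theta habitat, UPPER HALF, items K2r0/K3/K4 only.** Integer models `M_E` (non-CM, `L(E,1) ≠ 0`, good ss at `2`, `a₂ = 0`), `M_A` (CM,
`L(A,1) ≠ 0`, good ss at `2`, `a₂ = 0`) and a Tschirnhaus pair `(q, r)` certifying `E[2] ≅ A[2]`
(`ThetaPartnerXRoute.exists_equivariant_addEquiv_geomTorsion_two_of_tschirnhaus`); PUB (`hmod`, `hGZK`, `h2`) + ITEMS BY NAME (`hK2` 20312, `hK3` 20308,
`hK4` 20309) ⟹ `MissingUpperBoundAt (M_E ⊗ ℚ) 2`. The three items are hypotheses; a half of BSD₂; BSD is not proved by any of this.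
[cite: Kobayashi2003, Thm. 1.2 and Thm. 4.1] [cite: Kato2004Asterisque, Thm. 12.4–12.5 (3)] [cite: BDKim2013, Cor. 3.15] [cite: PollackRubin2004, Thm. 7.3]
[cite: AbbesUllmo1996, Thm. A] [cite: SilvermanAEC2009, III.§1] [cite: Miller2011LMS, Def. 1.1] -/
theorem missingUpperBoundAt_two_baseChange_int_of_thetaPartnerItems_at
    (hmod : nonempty_modularParametrizationData) (hGZK : rank_eq_analyticRank_of_analyticRank_le_one)
    (h2 : realPeriodRat_eq_unit_mul_plusPeriod_two)
    (hK2 : Summit.BirchSwinnertonDyer.BirchSwinnertonDyer.Theses.ThetaPartnerAtTwo.SignedMainConjectureCMTwoRankZero)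
    (hK3 : Summit.BirchSwinnertonDyer.BirchSwinnertonDyer.Theses.ThetaPartnerAtTwo.SignedKatoDivisibilityUpToAtTwo)
    (hK4 : Summit.BirchSwinnertonDyer.BirchSwinnertonDyer.Theses.ThetaPartnerAtTwo.SignedControlAtTwo)
    (hcm : ¬ (ME.baseChange ℚ).HasCM) (hL : (ME.baseChange ℚ).entireLFunction 1 ≠ 0)
    (hss : GoodSS (ME.baseChange ℚ) 2) (ha : (ME.baseChange ℚ).frobeniusTrace 2 = 0)
    (hAcm : (MA.baseChange ℚ).HasCM) (hLA : (MA.baseChange ℚ).entireLFunction 1 ≠ 0)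
    (hAss : GoodSS (MA.baseChange ℚ) 2) (hAa : (MA.baseChange ℚ).frobeniusTrace 2 = 0)
    (q r : ℚ[X])
    (hroot : ∀ ξ : AlgebraicClosure ℚ, Polynomial.aeval ξ (ME.baseChange ℚ).twoTorsionPolynomial.toPoly = 0 →
      Polynomial.aeval (Polynomial.aeval ξ q) (MA.baseChange ℚ).twoTorsionPolynomial.toPoly = 0)
    (hinv : ∀ ξ : AlgebraicClosure ℚ, Polynomial.aeval ξ (ME.baseChange ℚ).twoTorsionPolynomial.toPoly = 0 →
      Polynomial.aeval (Polynomial.aeval ξ q) r = ξ) :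
    MissingUpperBoundAt (ME.baseChange ℚ) 2 := by
  obtain ⟨e, he⟩ := ThetaPartnerXRoute.exists_equivariant_addEquiv_geomTorsion_two_of_tschirnhaus (K := ℚ)
    two_ne_zero (ME.baseChange ℚ) (MA.baseChange ℚ) q r hroot hinv
  exact SSMazurTate.missingUpperBoundAt_two_of_thetaPartnerItems_at hmod hGZK h2 hK2 hK3 hK4
    (ME.baseChange ℚ) hcm (analyticRank_eq_zero_of_entireLFunction_one_ne_zero _ hL) hss ha
    (MA.baseChange ℚ) hAcm (analyticRank_eq_zero_of_entireLFunction_one_ne_zero _ hLA) hAss hAa e he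

end Door

end SSThetaRoad

end Summit.BirchSwinnertonDyer.BirchSwinnertonDyer.Theorems

end
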